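import Summits.CriticalPhenomena.PercolationContinuityZ3.Theorems.Transplant.SkelPhiEquilibrium
import Summits.CriticalPhenomena.PercolationContinuityZ3.Theorems.Transplant.SkelPhiInfClusterMeetsEq
import Summits.CriticalPhenomena.PercolationContinuityZ3.Theorems.Transplant.SkelPhiFatSeqOff
import HarnessLib

/-!
# N1 (the {±1} node), LEVEL 0, file (L0-4a): the EQUILIBRIUM DATA AT `p` — `Skelφ.Eq.exists_equilibrium_data`: under the two-axis dictionary with a central
# inversion at a base vertex `t ∈ types`, `θ(p) > 0` somewhere, `0 < p < 1` and a.s. uniqueness of the infinite cluster, for every `ε ∈ (0,1)` there are a FAT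
# SEED `fatSeq t k` (ρ-invariant, `P(SEED ↔ ∞) ≥ 1 − (ε/2)³²`), a zone threshold `M₀ ≥ k` and a width threshold FUNCTION `n₁ : ℕ → ℕ` such that
# `EquilibriumAtW G φ p t (fatSeq t k) M (fatRadius) ε n` holds for every `M ≥ M₀` and `n ≥ n₁ M`
# (radius data = the fat radius `ψ`: seeds nest, `ψ ≥ id`, cylinder tails `≤ 2^{−L} ≤ ε/2`)

This discharges every hypothesis of `exists_equilibriumW` except the node's binders: `MeetsAS` by p1's `meetsAS_compl_strip/_compl_Xinf` (L0-2), the seed by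
`exists_real_seedPerc_fatSeq_gt`, the tails by `real_biUnion_cylReach_fat_le`.  Step I″ proper ((L0-4b): events, zones, kit block) consumes this record.
builds on p205010 (kernel theorem, internal audit signed; external expert review pending) — nothing here uses p205010; nothing is claimed about the open node
`SamePDropOfSkeletonNeg`.  Lane `prim-bschramm`, seat `prim-bschramm-p3` (gen 8; design owner); helper file (`--supports stmt-CriticalPhenomena-4575`); NEG-SCOPE §3.
[cite: MartineauTassion2017, §3.2 Lemma 3.5, §3.3 Lemma 3.7 (choice of k, n)] [cite: GrimmettPercolation1999, §8.2 Thm 8.1 (uniqueness input)]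
-/

noncomputable section

namespace Summit.CriticalPhenomena.PercolationContinuityZ3.Theorems.Transplant

namespace Skelφ

namespace Eq

open MeasureTheory ProbabilityTheory Filter Topology Literature.Probability.Percolation Literature.Probability.LatticeModels SimpleGraph KNLevels
open scoped Classical

variable {V : Type} {G : SimpleGraph V} {φ : V → Site 2} {t : V}

/-- The fat seeds are invariant under a central inversion at their base vertex. [cite: MartineauTassion2017, §3.2 (−A = A)] -/
theorem preimage_fatSeq_of_neg [Countable V] [G.LocallyFinite] {types : Finset V} (hfr : Frames G φ types) {p : unitInterval} (hC : CylSubcritical G φ types p)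
    {ρ : G ≃g G} (hρt : ρ t = t) (hρφ : ∀ w, φ (ρ w) - φ t = -(φ w - φ t)) (k : ℕ) :
    ρ ⁻¹' (↑(fatSeq hfr hC t k) : Set V) = ↑(fatSeq hfr hC t k) := by
  have hcoe : (↑(fatSeq hfr hC t k) : Set V) = cylBall G φ t k (fatRadius hfr hC k) := by
    ext v; rw [Finset.mem_coe, mem_fatSeq_iff]
  have himg := image_cylBall_of_boxMap hρt (f := fun y => -y) hρφ (ℓ := k)
    (fun y => by simp only [mem_box, Pi.neg_apply]; exact ⟨fun hy i => by have := hy i; omega, fun hy i => by have := hy i; omega⟩) (fatRadius hfr hC k)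
  rw [hcoe]
  conv_lhs => rw [← himg]
  exact Set.preimage_image_eq _ ρ.injective

/-- The fat seeds nest along the levels (as finsets). [folklore] -/
theorem fatSeq_subset_fatSeq [Countable V] [G.LocallyFinite] {types : Finset V} (hfr : Frames G φ types) {p : unitInterval} (hC : CylSubcritical G φ types p)
    (t : V) {k L : ℕ} (hkL : k ≤ L) : fatSeq hfr hC t k ⊆ fatSeq hfr hC t L := by
  intro v hv
  rw [mem_fatSeq_iff] at hv ⊢
  exact cylBall_mono G φ t hkL (fatRadius_mono hfr hC hkL) hv

/-- **The equilibrium data at `p`** (MT17 Lemma 3.5 with all analytic inputs discharged; thresholds as a function of the zone size).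
[cite: MartineauTassion2017, §3.2 Lemma 3.5; §3.3 Lemma 3.7] -/
theorem exists_equilibrium_data [Countable V] [G.LocallyFinite] {types : Finset V} (hc : G.Preconnected) (hlip : Lip G φ) (hst : Steps G φ)
    (hfr : Frames G φ types) (hκ : CylConn G φ types) {p : unitInterval} (hC : CylSubcritical G φ types p) (hp0 : 0 < (p : ℝ)) (hp1 : (p : ℝ) < 1)
    (hU : ∀ᵐ ω ∂bondPercolation G p, numInfiniteClusters ω ≤ 1) {z : V} (hθ : 0 < theta G z p) (ht : t ∈ types) {ρ : G ≃g G} (hρt : ρ t = t)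
    (hρφ : ∀ w, φ (ρ w) - φ t = -(φ w - φ t)) {ε : ℝ} (hε0 : 0 < ε) (hε1 : ε < 1) :
    ∃ (k M₀ : ℕ) (n₁ : ℕ → ℕ), 1 ≤ k ∧ k ≤ M₀ ∧
      1 - (ε / 2) ^ 32 ≤ (bondPercolation G p).real (TwoAxis.SeedPerc (↑(fatSeq hfr hC t k) : Set V)) ∧
      ∀ M, M₀ ≤ M → ∀ n, n₁ M ≤ n → EquilibriumAtW G φ p t (fatSeq hfr hC t k) M (fatRadius hfr hC) ε n := by
  set μ := bondPercolation G p with hμ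
  have hε2 : 0 < ε / 2 := by positivity
  have hε21 : ε / 2 < 1 := by linarith
  -- the fat seed
  obtain ⟨k, hk1, hk⟩ := exists_real_seedPerc_fatSeq_gt hfr hC hκ hθ ht (η := (ε / 2) ^ 32) (by positivity) 1
  have hseed : 1 - (ε / 2) ^ 32 ≤ μ.real (TwoAxis.SeedPerc (↑(fatSeq hfr hC t k) : Set V)) := (hk k le_rfl).le
  -- the tail budget `2^{-M} ≤ ε/2`
  obtain ⟨m, hm⟩ := exists_pow_lt_of_lt_one hε2 (show (1 / 2 : ℝ) < 1 by norm_num)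
  set M₀ : ℕ := max (k + 1) m with hM₀
  have key : ∀ M, ∃ n₁ : ℕ, M₀ ≤ M → ∀ n, n₁ ≤ n → EquilibriumAtW G φ p t (fatSeq hfr hC t k) M (fatRadius hfr hC) ε n := by
    intro M
    by_cases hM : M₀ ≤ M
    swap
    · exact ⟨0, fun h => absurd h hM⟩
    have hkM : k + 1 ≤ M := le_trans (le_max_left _ _) hM
    have hmM : m ≤ M := le_trans (le_max_right _ _) hM
    have hSM : (↑(fatSeq hfr hC t k) : Set V) ⊆ cyl φ t M := (fatSeq_subset_cyl hfr hC t k).trans (cyl_mono φ t (by omega))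
    have hQx : ∀ σu : ℤˣ, MeetsAS G p (Xinf φ t (σu : ℤ) (M + 3))ᶜ := fun σu =>
      meetsAS_compl_Xinf hc hfr hst hlip hU t (by rcases Int.units_eq_one_or σu with h | h <;> simp [h]) (M + 3)
    have htail : ∀ L, M ≤ L → μ.real (⋃ b ∈ fatSeq hfr hC t k, cylReach G φ t L (fatRadius hfr hC L - 1) b) ≤ ε / 2 := by
      intro L hL
      have h1 := real_biUnion_cylReach_fat_le hfr hC ht (n := L) (by omega) (fatSeq_subset_fatSeq hfr hC t (show k ≤ L - 1 by omega))
      have h2 : (1 / 2 : ℝ) ^ L ≤ (1 / 2) ^ m := pow_le_pow_of_le_one (by norm_num) (by norm_num) (by omega)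
      linarith
    obtain ⟨n₁, hn₁⟩ := exists_equilibriumW (t := t) hlip hst hfr hC hp0 hp1 hρt hρφ (M := M) (by omega) (fatSeq hfr hC t k)
      ((mem_fatSeq_iff hfr hC).2 (self_mem_cylBall G φ t k _)) hSM (preimage_fatSeq_of_neg hfr hC hρt hρφ k)
      (fun n => meetsAS_compl_strip hc hfr hst hlip hU t n) hQx hε2 hε21 hseed (fatRadius hfr hC)
      (fun L hL => le_trans (by omega) (le_fatRadius hfr hC L))
      (fun L hL v hv => cylBall_mono G φ t (by omega) (fatRadius_mono hfr hC (by omega)) ((mem_fatSeq_iff hfr hC).1 (Finset.mem_coe.1 hv)))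
      htail
    refine ⟨n₁, fun _ n hn => ?_⟩
    have := hn₁ n hn
    rwa [add_halves] at this
  choose n₁ hn₁ using key
  exact ⟨k, M₀, n₁, hk1, le_trans (Nat.le_succ _) (le_max_left _ _), hseed, fun M hM n hn => hn₁ M hM n hn⟩

end Eq

end Skelφ

end Summit.CriticalPhenomena.PercolationContinuityZ3.Theorems.Transplant

end
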